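import Summits.ResolutionOfSingularities.ResolutionOfSingularities.Theorems.FrobeniusLadderFInjectiveMacaulayficationOmegaOneS2KNewtonKCoverRecords0
import Summits.ResolutionOfSingularities.ResolutionOfSingularities.Theorems.FrobeniusLadderFInjectiveMacaulayficationFanCheckChunks
import HarnessLib

/-!
# HEAVY KERNEL CHECKS (cover records) of the BED Ω₁ refined class model X̃₂ class-route certificate: the sparse multi-vertex cover records, ONE `decide +kernel` per block `j` of the product table
# (crux `FInjectiveMacaulayfication` stmt-ResolutionOfSingularities-15315, chain w45a; Omega1 F6 W1, res-L1-w45a-plan-1 R23.23 (1) F6; seat res-L1-w45a-stub-3 g12)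

Support file for crux stmt-ResolutionOfSingularities-15315 (`FrobeniusLadder.FInjectiveMacaulayfication`), chain w45a.
[OURS · L1 W4.5a] — NOT a statement of any manuscript; AI-written, weaker than expert review.

`FanCheckChunks.checkHcovMultiL 5 (blockGens KL2 j) MV2 50 1223 (RLMB j)` for `j = 0,…,4` (block `j` = the 6032 generators `b + e_j`, records `RLM2_j` of `OmegaOneS2KNewtonKCoverRecords0–4`,
kit job j329694-konly), and the `∀ j < 5` form consumed by `FanCheckChunks.hcov_of_blocks`. No definitions, no named facts. [folklore]
-/

-- single-problem summit: the doubled namespace component is forced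
set_option linter.dupNamespace false

namespace Summit.ResolutionOfSingularities.ResolutionOfSingularities.Theorems.FInjectiveMacaulayfication.OmegaOneS2KNewtonKFan

open Summit.ResolutionOfSingularities.ResolutionOfSingularities.Theorems.FInjectiveMacaulayfication
open FanCheckKit FanCheckSound FanCheckChunks

/-- ★ ALL 121 generator chunks at once: `checkHcovMultiL` on every (generator chunk, record chunk) pair (ONE `decide +kernel`; every record has ≤ 2 vertices). -/
theorem check_hcov_all : ((List.range 121).all fun i => FanCheckChunks.checkHcovMultiL 5 (AL2.getD i []) MV2 50 1223 (RLM2_0.getD i [])) = true := by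
  decide +kernel

/-- The chunkwise shape consumed with `FanCheckChunks.hcov_of_checkMultiL` (every `a ∈ genSet 5 AL2` lies in some chunk `AL2.getD i []`, `i < 121 = AL2.length`). -/
theorem check_hcov_chunks : ∀ i < 121, FanCheckChunks.checkHcovMultiL 5 (AL2.getD i []) MV2 50 1223 (RLM2_0.getD i []) = true := by
  intro i hi
  exact List.all_eq_true.mp check_hcov_all i (List.mem_range.mpr hi)

/-- `AL2` has 121 chunks (with the specimen-distinct conjunct on `RLM2_0`). -/
theorem al2_len : AL2.length = 121 ∧ RLM2_0.length = 121 := by decide +kernel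

end Summit.ResolutionOfSingularities.ResolutionOfSingularities.Theorems.FInjectiveMacaulayfication.OmegaOneS2KNewtonKFan
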